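import Mathlib
import Summits.QuantumAdvantage.QuantumAdvantage.Theorems.GradeDialA
import Summits.QuantumAdvantage.AdviceFreeQNC0.AffBells23RingCond
import HarnessLib
import HarnessLib.Audit

/-!
# GradeDial, part B/2 — the walk → ring transport AT THE QUASI-POLYNOMIAL GRADE; proofs of the open items 26768
`PolyLossBridgeOdd` (both copies: `AbsorptionDial`, `DeterministicLeaf`), 26765 `DeterministicLeaf.XformRingPolyLoss8`,
26766 `DeterministicLeaf.XformDetSep`

Prop-free tree twin of the decomposition-cell node «GradeDial» (cell decomp-qadv, lens-5 g25), continued from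
`Theorems.GradeDialA` (the Razborov–Smolensky bridge `detSepOdd_of_ringQuasiLoss8Odd`, item 26764).

The landed constant-`θ` transports `walkTransportF` (walk game → odd-class ring, same bound, degree exponent
`c ↦ 2c+1`, charge `n+2`) and `ringHardOfOdd` (odd class ∪ even class, `card_even_class_le`) are re-run VERBATIM with
the constant bound `θ·2ⁿ` replaced by an arbitrary bound `W` (`oddClass_le_of_walk_bound`, `ring_le_of_oddClass_bound`);
at the quasi grade this costs one unit of exponent (`2^{(log₂ n)^A + 1} ≤ 2^{(log₂ (n+1))^{A+1}}`,
`ringQuasi_of_walkQuasi`).  Composed with part A: `WalkPolyLossOdd → DetSepOdd` (26768).  The X-form records 26765 /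
26766 are the constant-`θ` chain `walkTransportF ∘ ringHardOfOdd ∘ ringHard8_of_ringHard` plus `k = 1`,
`t ≥ ⌈1/(1−θ)⌉` (`ringPolyLoss8_of_ringHard8`, after the cell's lens-6 file) and part A's `detBridgeOdd_holds`.

Sources: as part A; the degree bookkeeping is the landed `AffBells23.RingCond.degBook` (imported; the annex copies `degree_bookkeepingF` / `log_succ_le` were removed at landing after gate dedup p816063) —
`AdviceFreeQNC0.OddPrimeTransport` (same statements).
-/

-- D-0017: single-conjunct summit ⇒ the duplicate `QuantumAdvantage.QuantumAdvantage` is mandated.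
set_option linter.dupNamespace false

noncomputable section

open Classical
open Finset Polynomial
open Literature.Computability.Cryptography Literature.Computability.Complexity
open Literature.Computability.QuantumComplexity Literature.Computability.MetaComplexity
open Summit.QuantumAdvantage.AdviceFreeQNC0
open Summit.QuantumAdvantage.QuantumAdvantage.Theses

namespace Summit.QuantumAdvantage.QuantumAdvantage.Theorems.GradeDial

/-! ### §1 The walk → ring transport at the quasi grade -/

/-- **graded walk → odd-class transport, per `n`** — the body of the landed `walkTransportF` with the constant bound
`θ·2ⁿ` replaced by an arbitrary bound `W`: a ring strategy `P` of degree `≤ (log₂ (n+1))^c` is beaten on the odd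
class by the transported walk strategy of degree `≤ (log₂ n)^{2c+1}` at charge `n + 2`. -/
theorem oddClass_le_of_walk_bound (p : ℕ) [Fact p.Prime] {n c : ℕ} (hn4p : 4 ^ (p + 1) ≤ n) {W : ℝ}
    (hW : ∀ y : Fin (n + 1) → (Fin n → Bool) → Bool,
      (∀ g, HasDegF p (y g) ((Nat.log 2 n) ^ (2 * c + 1))) →
        ((univ.filter fun u : Fin n → Bool => ringWinU (n + 2) y u = true).card : ℝ) ≤ W)
    (P : Fin (n + 1) → Smolensky.CubeFn (ZMod p) (n + 1))
    (hP : ∀ i, P i ∈ Smolensky.lowDeg (ZMod p) (n + 1) ((Nat.log 2 (n + 1)) ^ c)) :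
    ((univ.filter fun x : Fin (n + 1) → Bool =>
        OddZeros x ∧ RingHLF.Rel x (fun i => decide (P i x = 1))).card : ℝ) ≤ W := by
  classical
  have hn4 : 4 ≤ n := le_trans (by
    calc (4 : ℕ) = 4 ^ 1 := by norm_num
      _ ≤ 4 ^ (p + 1) := Nat.pow_le_pow_right (by norm_num) (by omega)) hn4p
  -- the transported walk strategy and its degree
  set z : (Fin (n + 1) → Bool) → (Fin (n + 1) → Bool) := fun x i => decide (P i x = 1) with hz
  set y : Fin (n + 1) → (Fin n → Bool) → Bool :=
    fun g u => xor (z (xOfU u) g) (tGuess (xOfU u) g) with hy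
  have hdeg : ∀ g, HasDegF p (y g) ((Nat.log 2 n) ^ (2 * c + 1)) := by
    intro g
    have h := hasDegF_transport (P g) (hP g) g
    unfold HasDegF at h ⊢
    exact Smolensky.lowDeg_mono (Summit.QuantumAdvantage.AdviceFreeQNC0.AffBells23.RingCond.degBook (Fact.out : p.Prime).two_le hn4p c) h
  have hwin := hW y hdeg
  -- inject the odd class into the walk game's winning inputs
  have hodd : (univ.filter fun x : Fin (n + 1) → Bool => OddZeros x ∧ RingHLF.Rel x (z x)).card ≤
      (univ.filter fun u : Fin n → Bool => ringWinU (n + 2) y u = true).card := by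
    refine Finset.card_le_card_of_injOn uVec ?_ ?_
    · intro x hx
      rw [Finset.mem_coe, mem_filter] at hx
      rw [Finset.mem_coe, mem_filter]
      exact ⟨mem_univ _, (rel_iff_ringWinU (by omega) x hx.2.1 z).1 hx.2.2⟩
    · intro x₁ hx₁ x₂ hx₂ h
      rw [Finset.mem_coe, mem_filter] at hx₁ hx₂
      rw [← xOfU_uVec (by omega) x₁ hx₁.2.1, ← xOfU_uVec (by omega) x₂ hx₂.2.1, h]
  exact le_trans (by exact_mod_cast hodd) hwin

/-- **graded odd class → all patterns, per `n`** — the body of the landed `ringHardOfOdd` with the bound abstract: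
the even class has at most `2ⁿ` of the `2^{n+1}` patterns (`card_even_class_le`). -/
theorem ring_le_of_oddClass_bound {p : ℕ} [Fact p.Prime] {n : ℕ}
    (P : Fin (n + 1) → Smolensky.CubeFn (ZMod p) (n + 1)) {W : ℝ}
    (hodd : ((univ.filter fun x : Fin (n + 1) → Bool =>
        OddZeros x ∧ RingHLF.Rel x (fun i => decide (P i x = 1))).card : ℝ) ≤ W) :
    ((univ.filter fun x : Fin (n + 1) → Bool =>
        RingHLF.Rel x (fun i => decide (P i x = 1))).card : ℝ) ≤ 2 ^ n + W := by
  classical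
  set Sx := univ.filter fun x : Fin (n + 1) → Bool => RingHLF.Rel x (fun i => decide (P i x = 1)) with hSx
  have hsplit : Sx.card = (Sx.filter OddZeros).card + (Sx.filter fun x => ¬ OddZeros x).card :=
    (Finset.card_filter_add_card_filter_not _).symm
  have heven : (Sx.filter fun x => ¬ OddZeros x).card ≤ 2 ^ n := by
    refine le_trans (Finset.card_le_card ?_) card_even_class_le
    intro x hx
    rw [mem_filter] at hx ⊢
    exact ⟨mem_univ _, hx.2⟩
  have hoddS : ((Sx.filter OddZeros).card : ℝ) ≤ W := by
    refine le_trans ?_ hodd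
    gcongr
    intro x hx
    rw [hSx, mem_filter, mem_filter] at hx
    rw [mem_filter]
    exact ⟨mem_univ _, hx.2, hx.1.2⟩
  have h1 : (Sx.card : ℝ) = ((Sx.filter OddZeros).card : ℝ) +
      ((Sx.filter fun x => ¬ OddZeros x).card : ℝ) := by
    rw [hsplit]; push_cast; ring
  have h2 : ((Sx.filter fun x => ¬ OddZeros x).card : ℝ) ≤ 2 ^ n := by exact_mod_cast heven
  linarith

/-- **graded transport, all lengths**: from the walk quasi grade with exponent `A`, the ring quasi grade with
exponent `A + 1` for every pattern length `N ≥ N₀(c)` (degree exponent `c` on the ring side costs `2c+1` on the walk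
side; the even class costs one unit of exponent: `2^{(log₂ n)^A + 1} ≤ 2^{(log₂ (n+1))^{A+1}}`). -/
theorem ringQuasi_of_walkQuasi (p : ℕ) [Fact p.Prime] {A : ℕ}
    (hA : ∀ C : ℕ, ∃ n₀ : ℕ, ∀ n ≥ n₀, ∀ c : ℕ,
      ∀ y : Fin (n + 1) → (Fin n → Bool) → Bool, (∀ g, HasDegF p (y g) ((Nat.log 2 n) ^ C)) →
        ((univ.filter fun u : Fin n → Bool => ringWinU c y u = true).card : ℝ) ≤
          (1 - 1 / (2 : ℝ) ^ ((Nat.log 2 n) ^ A)) * (2 : ℝ) ^ n) :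
    ∀ c : ℕ, ∃ N₀ : ℕ, ∀ N ≥ N₀, ∀ P : Fin N → Smolensky.CubeFn (ZMod p) N,
      (∀ i, P i ∈ Smolensky.lowDeg (ZMod p) N ((Nat.log 2 N) ^ c)) →
      ((univ.filter fun x : Fin N → Bool =>
          RingHLF.Rel x (fun i => decide (P i x = 1))).card : ℝ) ≤
        (1 - 1 / (2 : ℝ) ^ ((Nat.log 2 N) ^ (A + 1))) * (2 : ℝ) ^ N := by
  intro c
  obtain ⟨n₀, hn₀⟩ := hA (2 * c + 1)
  refine ⟨max (n₀ + 1) (4 ^ (p + 1) + 1), fun N hN P hP => ?_⟩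
  have hN₁ : n₀ + 1 ≤ N := le_of_max_le_left hN
  have hN₂ : 4 ^ (p + 1) + 1 ≤ N := le_of_max_le_right hN
  obtain ⟨n, rfl⟩ : ∃ n, N = n + 1 := ⟨N - 1, by omega⟩
  have hn₀n : n₀ ≤ n := by omega
  have hn4p : 4 ^ (p + 1) ≤ n := by omega
  have hodd := oddClass_le_of_walk_bound p hn4p (fun y hy => hn₀ n hn₀n (n + 2) y hy) P hP
  have hall := ring_le_of_oddClass_bound P hodd
  -- exponent bookkeeping
  have h16 : 16 ≤ n := le_trans (by
    calc (16 : ℕ) = 4 ^ 2 := by norm_num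
      _ ≤ 4 ^ (p + 1) := Nat.pow_le_pow_right (by norm_num) (by
          have := (Fact.out : p.Prime).two_le; omega)) hn4p
  have hL : 2 ≤ Nat.log 2 (n + 1) := Nat.le_log_of_pow_le one_lt_two (by omega)
  have hmono : Nat.log 2 n ≤ Nat.log 2 (n + 1) := Nat.log_mono_right (by omega)
  have hexp : (Nat.log 2 n) ^ A + 1 ≤ (Nat.log 2 (n + 1)) ^ (A + 1) := by
    have h1 : (Nat.log 2 n) ^ A ≤ (Nat.log 2 (n + 1)) ^ A := Nat.pow_le_pow_left hmono _
    have h2 : 1 ≤ (Nat.log 2 (n + 1)) ^ A := Nat.one_le_pow _ _ (by omega)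
    calc (Nat.log 2 n) ^ A + 1 ≤ (Nat.log 2 (n + 1)) ^ A + (Nat.log 2 (n + 1)) ^ A := by omega
      _ = 2 * (Nat.log 2 (n + 1)) ^ A := by ring
      _ ≤ Nat.log 2 (n + 1) * (Nat.log 2 (n + 1)) ^ A := Nat.mul_le_mul_right _ hL
      _ = (Nat.log 2 (n + 1)) ^ (A + 1) := by ring
  have hfrac : 1 / (2 : ℝ) ^ ((Nat.log 2 (n + 1)) ^ (A + 1)) ≤ 1 / (2 : ℝ) ^ ((Nat.log 2 n) ^ A + 1) :=
    one_div_le_one_div_of_le (by positivity) (pow_le_pow_right₀ (by norm_num) hexp)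
  have h2n : (0 : ℝ) ≤ (2 : ℝ) ^ (n + 1) := by positivity
  calc ((univ.filter fun x : Fin (n + 1) → Bool =>
          RingHLF.Rel x (fun i => decide (P i x = 1))).card : ℝ)
      ≤ 2 ^ n + (1 - 1 / (2 : ℝ) ^ ((Nat.log 2 n) ^ A)) * (2 : ℝ) ^ n := hall
    _ = (1 - 1 / (2 : ℝ) ^ ((Nat.log 2 n) ^ A + 1)) * (2 : ℝ) ^ (n + 1) := by
        rw [pow_succ, pow_succ]; ring
    _ ≤ (1 - 1 / (2 : ℝ) ^ ((Nat.log 2 (n + 1)) ^ (A + 1))) * (2 : ℝ) ^ (n + 1) :=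
        mul_le_mul_of_nonneg_right (by linarith) h2n

/-- the walk-grain 1/poly grade (T, 26767) implies the walk quasi grade (schedule `A = 2`). -/
theorem walkQuasi_of_walkPolyLossOdd (hT : AbsorptionDial.WalkPolyLossOdd) (p : ℕ) [Fact p.Prime] (hp : 5 ≤ p) :
    ∀ C : ℕ, ∃ n₀ : ℕ, ∀ n ≥ n₀, ∀ c : ℕ,
      ∀ y : Fin (n + 1) → (Fin n → Bool) → Bool, (∀ g, HasDegF p (y g) ((Nat.log 2 n) ^ C)) →
        ((univ.filter fun u : Fin n → Bool => ringWinU c y u = true).card : ℝ) ≤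
          (1 - 1 / (2 : ℝ) ^ ((Nat.log 2 n) ^ 2)) * (2 : ℝ) ^ n := by
  intro C
  obtain ⟨k, n₀, h⟩ := hT p hp C
  refine ⟨max n₀ (2 ^ (k + 1)), fun n hn c y hy => ?_⟩
  have hn₀ : n₀ ≤ n := le_of_max_le_left hn
  have hnk : 2 ^ (k + 1) ≤ n := le_of_max_le_right hn
  exact (h n hn₀ c y hy).trans (poly_bound_le_quasi_bound hnk _ (by positivity))

/-- **item 26768 `AbsorptionDial.PolyLossBridgeOdd` PROVED**: `WalkPolyLossOdd → DetSepOdd`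
(walk 1/poly ⟹ walk quasi (A = 2) ⟹ ring quasi (A = 3) ⟹ DetSepOdd). -/
theorem polyLossBridgeOdd_holds : AbsorptionDial.PolyLossBridgeOdd := by
  intro hT
  refine detSepOdd_of_ringQuasiLoss8Odd fun p _ hp => ⟨2 + 1, fun c => ?_⟩
  obtain ⟨N₀, hN₀⟩ := ringQuasi_of_walkQuasi p (walkQuasi_of_walkPolyLossOdd hT p hp) c
  exact ⟨N₀, fun t ht P hP => hN₀ (8 * t) (by omega) P hP⟩

/-- **item 26768, the `DeterministicLeaf` copy** (same statement). -/
theorem polyLossBridgeOdd_holds' : DeterministicLeaf.PolyLossBridgeOdd := polyLossBridgeOdd_holds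

/-! ### §2 The X-form records (26765, 26766) -/

/-- constant ring-8 hardness gives the 1/poly grade (`k = 1`, `t ≥ ⌈1/(1−θ)⌉`); after lens-6's
`ringPolyLoss8_of_ringHard8`. -/
theorem ringPolyLoss8_of_ringHard8 (p : ℕ) [Fact p.Prime] (h : RingHard8 p) :
    ∀ c : ℕ, ∃ k t₀ : ℕ, ∀ t ≥ t₀,
      ∀ P : Fin (8 * t) → Smolensky.CubeFn (ZMod p) (8 * t),
        (∀ i, P i ∈ Smolensky.lowDeg (ZMod p) (8 * t) ((Nat.log 2 (8 * t)) ^ c)) →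
        ((univ.filter fun x : Fin (8 * t) → Bool =>
            RingHLF.Rel x (fun i => decide (P i x = 1))).card : ℝ) ≤
          (1 - 1 / (((8 * t : ℕ) : ℝ)) ^ k) * (2 : ℝ) ^ (8 * t) := by
  obtain ⟨θ, hθ, hC⟩ := h
  intro c
  obtain ⟨t₀, ht₀⟩ := hC c
  refine ⟨1, max t₀ (⌈1 / (1 - θ)⌉₊ + 1), fun t ht P hP => ?_⟩
  have ht₁ : t₀ ≤ t := le_trans (le_max_left _ _) ht
  have ht₂ : ⌈1 / (1 - θ)⌉₊ + 1 ≤ t := le_trans (le_max_right _ _) ht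
  have hpos : (0 : ℝ) < 1 - θ := by linarith
  have h8tpos : (0 : ℝ) < ((8 * t : ℕ) : ℝ) := by exact_mod_cast (show 0 < 8 * t by omega)
  have hceil : (⌈1 / (1 - θ)⌉₊ : ℝ) ≤ ((8 * t : ℕ) : ℝ) := by
    exact_mod_cast (show ⌈1 / (1 - θ)⌉₊ ≤ 8 * t by omega)
  have h1 : 1 / (1 - θ) ≤ ((8 * t : ℕ) : ℝ) := le_trans (Nat.le_ceil _) hceil
  have h2 : 1 ≤ ((8 * t : ℕ) : ℝ) * (1 - θ) := by
    have := (div_le_iff₀ hpos).mp h1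
    linarith
  have h3 : 1 / ((8 * t : ℕ) : ℝ) ≤ 1 - θ := by
    rw [div_le_iff₀ h8tpos]
    linarith
  have hθn : θ ≤ 1 - 1 / (((8 * t : ℕ) : ℝ)) ^ 1 := by
    rw [pow_one]
    linarith
  calc ((univ.filter fun x : Fin (8 * t) → Bool =>
          RingHLF.Rel x (fun i => decide (P i x = 1))).card : ℝ)
      ≤ θ * (2 : ℝ) ^ (8 * t) := ht₀ t ht₁ P hP
    _ ≤ (1 - 1 / (((8 * t : ℕ) : ℝ)) ^ 1) * (2 : ℝ) ^ (8 * t) :=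
        mul_le_mul_of_nonneg_right hθn (by positivity)

/-- **item 26765 `DeterministicLeaf.XformRingPolyLoss8` PROVED**: the X-form «∀ p ≥ 5, WalkHardF p» implies
`RingPolyLoss8Odd` through the landed chain `walkTransportF`, `ringHardOfOdd`, `ringHard8_of_ringHard`. -/
theorem xformRingPolyLoss8_holds : DeterministicLeaf.XformRingPolyLoss8 :=
  fun h p _ hp => ringPolyLoss8_of_ringHard8 p
    (ringHard8_of_ringHard p (ringHardOfOdd p (walkTransportF p (h p hp))))

/-- **item 26766 `DeterministicLeaf.XformDetSep` PROVED**: the X-form gives the deterministic leaf. -/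
theorem xformDetSep_holds : DeterministicLeaf.XformDetSep :=
  fun h => detBridgeOdd_holds (xformRingPolyLoss8_holds h)

end Summit.QuantumAdvantage.QuantumAdvantage.Theorems.GradeDial

end
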